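import Summits.BirchSwinnertonDyer.BirchSwinnertonDyer.Theses.FrozenTwin
import Summits.BirchSwinnertonDyer.BirchSwinnertonDyer.Theses.SelmerRank
import Summits.BirchSwinnertonDyer.BirchSwinnertonDyer.Theorems.TangentConeSelmerRankSmallImageReduction
import Literature.NumberTheory.EllipticCurves.BSDSelmerParityDokchitserProofs

/-!
# Logical position of crux `UBPotentiallyGood` (stmt-BirchSwinnertonDyer-15878), kernel-checked

Crux-attack workfile (refuter, 2026-08-17). `C := FrozenTwin.UBPotentiallyGood` (byte-identical to
`ToricShedding.UBPotentiallyGood`, `Iff.rfl`). Positive lemmas only — evidence for provers /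
planners (a refuter lands nothing positive under `Theorems/`):

* (P1) `S ∧ ShaPFinite → C` : the summit `S = BirchSwinnertonDyer` (rank only!) gives `C` only
  together with `p`-primary Ш-finiteness (Greenberg's identity): `S` alone does NOT give `C`.
* (P2) `SelmerRankUB → C` : `C` is route SelmerRank's crux UB (stmt-0130) restricted to the sector.
* (P3) `C → (rank ≤ r_an)` on the non-CM part of the sector: what `C` buys towards `S`.
* (P4) `C` holds in analytic rank ≤ 1 modulo the GZK fact (the known slice).
* (P5) every side condition of `C` is TOOL-driven: the hypothesis-free statement
  `∀ W p, corank_p ≤ r_an` implies `C` (trivially) and is itself implied by BSD-rank + Ш[p^∞]-finite. -/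

open Summit.BirchSwinnertonDyer.BirchSwinnertonDyer.Theses
open Summit.BirchSwinnertonDyer.BirchSwinnertonDyer.Theorems
open Literature.NumberTheory.EllipticCurves

set_option linter.dupNamespace false

namespace Summit.BirchSwinnertonDyer.BirchSwinnertonDyer.Cruxes.UBPotentiallyGood.CruxAttack

/-- The crux, by name. [folklore] -/
abbrev C : Prop := FrozenTwin.UBPotentiallyGood

/-- (P1) summit + p-primary Ш-finiteness ⇒ C. [folklore] -/
theorem ub_of_bsd_of_shaPFinite (hS : BirchSwinnertonDyer) (hSha : FrozenTwin.SelmerRankShaPFinite) : C := by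
  intro W _ _ _ p _ _ _ _ _
  have h1 : W.selmerCorank p = W.mordellWeilRank + W.shaCorank p :=
    W.selmerCorank_eq_mordellWeilRank_add_holds p
  have h2 : W.shaCorank p = 0 := Literature.BSD.shaCorank_eq_zero_of_finite W p (hSha W p)
  have h3 : W.analyticRank = W.mordellWeilRank := hS W inferInstance
  omega

/-- (P1') more precisely, what C needs beyond S is exactly `shaCorank p = 0` on the sector. [folklore] -/
theorem ub_of_bsd_of_shaCorank_zero (hS : BirchSwinnertonDyer)
    (hZ : ∀ (W : WeierstrassCurve ℚ) [W.IsElliptic] (p : ℕ) [Fact p.Prime], W.shaCorank p = 0) : C := by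
  intro W _ _ _ p _ _ _ _ _
  have h1 := W.selmerCorank_eq_mordellWeilRank_add_holds p
  have h2 := hZ W p
  have h3 : W.analyticRank = W.mordellWeilRank := hS W inferInstance
  omega

/-- (P1'') and conversely, under S, C says exactly `shaCorank p = 0` at the sector's big-image ordinary primes. [folklore] -/
theorem shaCorank_zero_of_bsd_of_ub (hS : BirchSwinnertonDyer) (hC : C)
    (W : WeierstrassCurve ℚ) [W.IsElliptic] [W.IsGloballyMinimal]
    (hpg : ¬ ∃ (q : ℕ) (_ : Fact q.Prime), W.HasMultiplicativeReductionAtPrime q)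
    (p : ℕ) [Fact p.Prime] (h5 : 5 ≤ p) (hg : W.HasGoodReductionAtPrime p)
    (ho : ¬ (p : ℤ) ∣ W.frobeniusTrace p) (hs : W.HasSurjectiveModNGaloisRep p) :
    W.shaCorank p = 0 := by
  have h1 := W.selmerCorank_eq_mordellWeilRank_add_holds p
  have h3 : W.analyticRank = W.mordellWeilRank := hS W inferInstance
  have h4 := hC W hpg p h5 hg ho hs
  omega

/-- (P2) C is SelmerRankUB (stmt-0130) restricted to the sector (drop one hypothesis). [folklore] -/
theorem ub_of_selmerRankUB (hUB : SelmerRank.SelmerRankUB) : C :=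
  fun W _ _ _ p _ h5 hg ho hs => hUB W p h5 hg ho hs

/-- (P3) what C buys towards the summit: the Mordell–Weil rank UPPER bound `rank ≤ r_an` for every
non-CM curve in the sector (Serre supply of a big-image ordinary prime, proved in tree). [folklore] -/
theorem rank_le_analyticRank_of_ub (hC : C) (W : WeierstrassCurve ℚ) [W.IsElliptic] [W.IsGloballyMinimal]
    (hW : ¬ W.HasCM) (hpg : ¬ ∃ (q : ℕ) (_ : Fact q.Prime), W.HasMultiplicativeReductionAtPrime q) :
    W.mordellWeilRank ≤ W.analyticRank := by
  obtain ⟨p, hp, h5, hgood, hord, hsurj⟩ := exists_goodOrdinary_surjective_of_not_hasCM W hW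
  have h1 := W.selmerCorank_eq_mordellWeilRank_add_holds p
  have h2 := hC W hpg p h5 hgood hord hsurj
  omega

/-- (P4) the known slice: C in analytic rank ≤ 1, modulo the GZK named fact. [folklore] -/
theorem ub_of_analyticRank_le_one (hGZK : rank_eq_analyticRank_of_analyticRank_le_one)
    (W : WeierstrassCurve ℚ) [W.IsElliptic] (p : ℕ) [Fact p.Prime] (h : W.analyticRank ≤ 1) :
    W.selmerCorank p ≤ W.analyticRank :=
  (selmerCorank_eq_analyticRank_of_analyticRank_le_one hGZK W p h).le

/-- (P5) mutation: the hypothesis-free statement implies C; all six side conditions are decoration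
for TRUTH (BSD + Ш-finite predict the bare inequality at every prime), they only select the TOOLS. [folklore] -/
theorem ub_of_bare (h : ∀ (W : WeierstrassCurve ℚ) [W.IsElliptic] (p : ℕ) [Fact p.Prime],
    W.selmerCorank p ≤ W.analyticRank) : C :=
  fun W _ _ _ p _ _ _ _ _ => h W p

end Summit.BirchSwinnertonDyer.BirchSwinnertonDyer.Cruxes.UBPotentiallyGood.CruxAttack
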